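import Summits.QuantumFields.YangMills.Theses.MultiscaleHerbst
import Summits.QuantumFields.YangMills.Theorems.FibreConvexityTailTwoSidedTailLChernoffOnEvent

/-!
# Route `MultiscaleHerbst` (ideator seat ym-r3-idea-2 g5), support item `TwoSidedOfWindowHerbstCap` (stmt-QuantumFields-28310):
# HERBST ON `[0, p]` + CHERNOFF — `WindowHerbstCapL → FibreConvexityTail.TwoSidedTailL` (critic VERDICT #112 price (2), BC5 weakest-sufficient)

Width seat ym-line-sfw-p2-w2 g20 (cell `ym-idea-1`, free hands).  Rung R3 of LADDER-YM is a RECORD rung: no summit and no mass gap is proved;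
the cruxes `WindowHerbstCapL`/`WindowHerbstL`, `TwoSidedTailL` (25567), `TowerTailL` (25568) stay open.  The uncapped twin is the tree's
`Theorems/MultiscaleHerbstTwoSidedOfWindowHerbst.lean` (seat ym-ust-19936-w2 g8, p643113); this file LOCALISES Herbst's argument in `t`.

THE ARGUMENT.
* §1 ★★ `herbst_mgf_le_of_le` (HERBST ON A CAPPED RANGE, abstract): `μ` finite, `X` bounded measurable, `m₀ = μ(univ)`.  If `∫ X dμ ≤ m·m₀` and the
  entropy bound `∫ e^{tX}·tX dμ − (∫ e^{tX} dμ)·log((∫ e^{tX} dμ)/m₀) ≤ (σ²t²/2)·∫ e^{tX} dμ` holds for `0 ≤ t ≤ T` ONLY, then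
  `∫ e^{tX} dμ ≤ m₀·exp(t·m + σ²t²/2)` for `0 ≤ t ≤ T`.  Proof (local in `t`): with `k(t) := cgf(t) − log m₀ − tm − σ²t²/2` (Mathlib's `mgf`/`cgf`
  calculus, `hasDerivAt_mgf`; every exponential moment of a bounded variable exists), the entropy bound reads `t·k′(t) − k(t) ≤ 0` on `[0, T]`, so
  `k(t)/t` is antitone on `(0, T]`; its limit at `0⁺` is `k′(0) = (∫X dμ)/m₀ − m ≤ 0`; hence `k ≤ 0` on `[0, T]`.
* §2 the item: per `(K, j, a)` with `g = g_{K−j}`, `p = p(g) ≥ 0` (as `γ ≤ γ₁ ≤ 1`), `X = |Ū^{j}(∂a) − 1|/g ∈ [0, 2/g]`, window `W ⊇ twoSidedEvent`: put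
  `σ' = max σ 1` and `t* = 3p/(4σ'²) ≤ p`; §1 on `Gibbs_K|W` gives `∫_W e^{t*X} ≤ Gibbs_K(W)·e^{t*p/4 + σ²t*²/2} ≤ e^{t*p/4 + σ'²t*²/2}`, monotonicity in
  the set moves it to `twoSidedEvent ⊆ W ∩ {p ≤ X}`, and Chernoff (`measure_ge_le_exp_mul_mgf`, exponent `ChernoffOnEvent.chernoff_exponent`) gives
  `Gibbs_K(twoSidedEvent) ≤ 1·β^0·exp(−(9/(32σ'²))·p²)`: `TwoSidedTailL` with `C = 1`, `A = 0`, `c = 9/(32·max(σ,1)²)`; `bmin`, `γ₁` pass through.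

References: D. Bakry, I. Gentil, M. Ledoux, *Analysis and Geometry of Markov Diffusion Operators* (Springer 2014), Prop. 5.4.1 (Herbst's argument);
S. Boucheron, G. Lugosi, P. Massart, *Concentration Inequalities* (OUP 2013) §2.3 (Chernoff); T. Bałaban, CMP **102** (1985) 255–275 [Balaban1985UV3] ((7) p.257).
-/

set_option autoImplicit false

noncomputable section

open MeasureTheory ProbabilityTheory Filter Topology Real
open scoped Topology

namespace Summit.QuantumFields.YangMills.Theorems.MultiscaleHerbstCap

/-! ## §1 Herbst's argument for a bounded observable on a finite measure space -/

section Herbst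

variable {Ω : Type*} [MeasurableSpace Ω]

/-- Bounded measurable observables have all exponential moments on a finite measure space. [folklore] -/
theorem integrable_exp_mul_of_bounded (μ : Measure Ω) [IsFiniteMeasure μ] {X : Ω → ℝ} (hXm : Measurable X) {B : ℝ}
    (hXb : ∀ ω, |X ω| ≤ B) (t : ℝ) : Integrable (fun ω => Real.exp (t * X ω)) μ := by
  refine (integrable_const (Real.exp (|t| * B))).mono' ((measurable_exp.comp (hXm.const_mul t)).aestronglyMeasurable)
    (ae_of_all _ fun ω => ?_)
  rw [Real.norm_eq_abs, abs_of_pos (Real.exp_pos _)]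
  refine Real.exp_le_exp.mpr ?_
  calc t * X ω ≤ |t * X ω| := le_abs_self _
    _ = |t| * |X ω| := abs_mul _ _
    _ ≤ |t| * B := mul_le_mul_of_nonneg_left (hXb ω) (abs_nonneg _)

/-- For a bounded observable every `t` is interior to the domain of the moment generating function. [folklore] -/
theorem mem_interior_integrableExpSet_of_bounded (μ : Measure Ω) [IsFiniteMeasure μ] {X : Ω → ℝ} (hXm : Measurable X) {B : ℝ}
    (hXb : ∀ ω, |X ω| ≤ B) (t : ℝ) : t ∈ interior (integrableExpSet X μ) := by
  have h : integrableExpSet X μ = Set.univ :=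
    Set.eq_univ_of_forall fun s => integrable_exp_mul_of_bounded μ hXm hXb s
  rw [h, interior_univ]; exact Set.mem_univ _

/-- ★★ **HERBST'S ARGUMENT ON A CAPPED RANGE** (module docstring, §1): an entropy bound `Ent_μ(e^{tX}) ≤ (σ²t²/2)·∫e^{tX} dμ` for `0 ≤ t ≤ T`
only and a mean bound `∫ X dμ ≤ m·μ(univ)` integrate to `∫ e^{tX} dμ ≤ μ(univ)·exp(t·m + σ²t²/2)` for `0 ≤ t ≤ T` (`X` bounded measurable, `μ`
finite) — Herbst's differential inequality is local in `t`. [cite: BakryGentilLedoux2014, Prop. 5.4.1] -/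
theorem herbst_mgf_le_of_le (μ : Measure Ω) [IsFiniteMeasure μ] {X : Ω → ℝ} (hXm : Measurable X) {B : ℝ} (hXb : ∀ ω, |X ω| ≤ B)
    {m σ T : ℝ}
    (hmean : ∫ ω, X ω ∂μ ≤ m * μ.real Set.univ)
    (hent : ∀ t : ℝ, 0 ≤ t → t ≤ T →
      (∫ ω, Real.exp (t * X ω) * (t * X ω) ∂μ) -
          (∫ ω, Real.exp (t * X ω) ∂μ) * Real.log ((∫ ω, Real.exp (t * X ω) ∂μ) / μ.real Set.univ) ≤
        σ ^ 2 * t ^ 2 / 2 * ∫ ω, Real.exp (t * X ω) ∂μ) :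
    ∀ t : ℝ, 0 ≤ t → t ≤ T → ∫ ω, Real.exp (t * X ω) ∂μ ≤ μ.real Set.univ * Real.exp (t * m + σ ^ 2 * t ^ 2 / 2) := by
  intro t₀ ht₀ ht₀T
  by_cases hμ : μ = 0
  · subst hμ; simp
  -- notation and positivity
  set m₀ : ℝ := μ.real Set.univ with hm₀
  have hm₀pos : 0 < m₀ := by
    rw [hm₀, measureReal_def, ENNReal.toReal_pos_iff]
    exact ⟨Measure.measure_univ_pos.mpr hμ, measure_lt_top _ _⟩
  have hI : ∀ t, t ∈ interior (integrableExpSet X μ) := mem_interior_integrableExpSet_of_bounded μ hXm hXb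
  have hint : ∀ t, Integrable (fun ω => Real.exp (t * X ω)) μ := integrable_exp_mul_of_bounded μ hXm hXb
  have hMpos : ∀ t, 0 < mgf X μ t := fun t => mgf_pos' hμ (hint t)
  have hM_eq : ∀ t, mgf X μ t = ∫ ω, Real.exp (t * X ω) ∂μ := fun t => rfl
  -- the derivative of the mgf and of the cgf
  set D : ℝ → ℝ := fun t => ∫ ω, X ω * Real.exp (t * X ω) ∂μ with hD
  have hmgf' : ∀ t, HasDerivAt (mgf X μ) (D t) t := fun t => hasDerivAt_mgf (hI t)
  have hcgf' : ∀ t, HasDerivAt (cgf X μ) (D t / mgf X μ t) t := fun t =>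
    (hmgf' t).log (hMpos t).ne'
  -- the comparison function `k` and its derivative `k'`
  set k : ℝ → ℝ := fun t => cgf X μ t - Real.log m₀ - t * m - σ ^ 2 * t ^ 2 / 2 with hk
  set k' : ℝ → ℝ := fun t => D t / mgf X μ t - m - σ ^ 2 * t with hk'
  have hkd : ∀ t, HasDerivAt k (k' t) t := by
    intro t
    have h1 : HasDerivAt (fun t : ℝ => t * m) m t :=
      ((hasDerivAt_id t).mul_const m).congr_deriv (by simp)
    have h2 : HasDerivAt (fun t : ℝ => σ ^ 2 * t ^ 2 / 2) (σ ^ 2 * t) t :=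
      (((hasDerivAt_pow 2 t).const_mul (σ ^ 2)).div_const 2).congr_deriv (by push_cast; ring)
    show HasDerivAt (fun t => cgf X μ t - Real.log m₀ - t * m - σ ^ 2 * t ^ 2 / 2) (D t / mgf X μ t - m - σ ^ 2 * t) t
    exact (((hcgf' t).sub_const (Real.log m₀)).sub h1).sub h2
  have hk0 : k 0 = 0 := by
    show cgf X μ 0 - Real.log m₀ - 0 * m - σ ^ 2 * 0 ^ 2 / 2 = 0
    rw [cgf_zero', ← hm₀]; ring
  -- (★★) `k'(0) ≤ 0` from the mean bound
  have hk'0 : k' 0 ≤ 0 := by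
    have hD0 : D 0 = ∫ ω, X ω ∂μ := by simp [hD]
    have hM0 : mgf X μ 0 = m₀ := by rw [mgf_zero', hm₀]
    simp only [hk', hD0, hM0, mul_zero, sub_zero]
    rw [sub_nonpos, div_le_iff₀ hm₀pos]
    exact hmean
  -- (★) `t·k'(t) − k(t) ≤ 0` for `0 ≤ t ≤ T`, from the entropy bound divided by `mgf t > 0`
  have hstar : ∀ t, 0 ≤ t → t ≤ T → t * k' t - k t ≤ 0 := by
    intro t ht htT
    have hM := hMpos t
    have he := hent t ht htT
    -- `∫ e^{tX}·(tX) = t·D t`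
    have h1 : ∫ ω, Real.exp (t * X ω) * (t * X ω) ∂μ = t * D t := by
      rw [hD]; simp only
      rw [← integral_const_mul]
      refine integral_congr_ae (ae_of_all _ fun ω => ?_)
      ring
    -- `log(M/m₀) = cgf − log m₀`
    have h2 : Real.log ((∫ ω, Real.exp (t * X ω) ∂μ) / μ.real Set.univ) = cgf X μ t - Real.log m₀ := by
      rw [← hM_eq, ← hm₀, Real.log_div (hM.ne') hm₀pos.ne']
      rfl
    rw [h1, h2, ← hM_eq] at he
    -- divide by `mgf t`
    have h3 : t * (D t / mgf X μ t) - (cgf X μ t - Real.log m₀) ≤ σ ^ 2 * t ^ 2 / 2 := by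
      rw [show t * (D t / mgf X μ t) - (cgf X μ t - Real.log m₀) =
        (t * D t - mgf X μ t * (cgf X μ t - Real.log m₀)) / mgf X μ t by field_simp]
      rw [div_le_iff₀ hM]
      linarith
    simp only [hk, hk']
    nlinarith [h3]
  -- `q(t) = k(t)/t` is antitone on `(0, T]`
  set q : ℝ → ℝ := fun t => k t / t with hq
  have hqd : ∀ t, 0 < t → HasDerivAt q ((k' t * t - k t * 1) / t ^ 2) t := fun t ht =>
    (hkd t).div (hasDerivAt_id t) ht.ne'
  have hq_anti : AntitoneOn q (Set.Ioc 0 T) := by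
    refine antitoneOn_of_hasDerivWithinAt_nonpos (convex_Ioc 0 T) (f' := fun t => (k' t * t - k t * 1) / t ^ 2) ?_ ?_ ?_
    · exact fun t ht => (hqd t ht.1).continuousAt.continuousWithinAt
    · intro t ht
      rw [interior_Ioc] at ht ⊢
      exact ((hqd t ht.1).hasDerivWithinAt)
    · intro t ht
      rw [interior_Ioc] at ht
      have := hstar t (le_of_lt ht.1) (le_of_lt ht.2)
      exact div_nonpos_of_nonpos_of_nonneg (by linarith) (sq_nonneg t)
  -- the limit of `q` at `0⁺` is `k'(0)`
  have hq_lim : Tendsto q (𝓝[>] 0) (𝓝 (k' 0)) := by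
    have h := (hkd 0).tendsto_slope
    have h' : Tendsto (slope k 0) (𝓝[>] 0) (𝓝 (k' 0)) :=
      h.mono_left (nhdsWithin_mono _ fun x hx => ne_of_gt hx)
    refine h'.congr' (eventually_nhdsWithin_of_forall fun t _ => ?_)
    rw [slope_def_field, hk0, sub_zero, sub_zero]
  -- hence `q(t₀) ≤ k'(0) ≤ 0` and `k(t₀) ≤ 0`
  have hk_nonpos : k t₀ ≤ 0 := by
    rcases eq_or_lt_of_le ht₀ with h | hpos
    · rw [← h, hk0]
    · have hqt : q t₀ ≤ k' 0 := by
        refine ge_of_tendsto hq_lim ?_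
        filter_upwards [Ioo_mem_nhdsGT hpos] with s hs
        exact hq_anti ⟨hs.1, hs.2.le.trans ht₀T⟩ ⟨hpos, ht₀T⟩ hs.2.le
      have : k t₀ = t₀ * q t₀ := by rw [hq]; field_simp
      rw [this]
      exact mul_nonpos_of_nonneg_of_nonpos hpos.le (hqt.trans hk'0)
  -- unwrap: `mgf t₀ = exp (cgf t₀) ≤ m₀·exp(t₀ m + σ² t₀²/2)`
  have hcgf_le : cgf X μ t₀ ≤ Real.log m₀ + (t₀ * m + σ ^ 2 * t₀ ^ 2 / 2) := by
    have : k t₀ = cgf X μ t₀ - Real.log m₀ - t₀ * m - σ ^ 2 * t₀ ^ 2 / 2 := rfl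
    linarith
  calc ∫ ω, Real.exp (t₀ * X ω) ∂μ = mgf X μ t₀ := (hM_eq t₀).symm
    _ = Real.exp (cgf X μ t₀) := (Real.exp_log (hMpos t₀)).symm
    _ ≤ Real.exp (Real.log m₀ + (t₀ * m + σ ^ 2 * t₀ ^ 2 / 2)) := Real.exp_le_exp.mpr hcgf_le
    _ = m₀ * Real.exp (t₀ * m + σ ^ 2 * t₀ ^ 2 / 2) := by rw [Real.exp_add, Real.exp_log hm₀pos]

end Herbst

/-! ## §2 The support item -/

open Literature.MathematicalPhysics.QuantumFieldTheory.Balaban1983to89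
open Literature.MathematicalPhysics.QuantumFieldTheory.Balaban1983to89.Missing
open Literature.MathematicalPhysics.QuantumFieldTheory.Balaban1983to89.T4Continuum
open Literature.MathematicalPhysics.QuantumFieldTheory.Balaban1983to89.T3ContinuumYM3Torus
open Literature.MathematicalPhysics.QuantumFieldTheory.Balaban1983to89.T3UnitScaleTilt
open Literature.MathematicalPhysics.QuantumFieldTheory.Balaban1983to89.T3UnitLawDensityEML (ℰp measurableE_ℰp)
open Literature.MathematicalPhysics.QuantumFieldTheory.Balaban1983to89.T4PairDerivBridge (dist1_le_two_specialUnitaryGroup)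
open Summit.QuantumFields.YangMills.Theorems.FibreConvexityTail

/-- `p(g) = b₀(1 + log g⁻¹)^{p₀} ≥ 0` for `0 < g ≤ 1`, `0 < b₀` (the base is `≥ 1`). [cite: Balaban1985UV3, (7) p.257] -/
theorem pFun_nonneg_of_le_one {b₀ p₀ g : ℝ} (hb₀ : 0 < b₀) (hg : 0 < g) (hg1 : g ≤ 1) : 0 ≤ B10.pFun b₀ p₀ g := by
  show 0 ≤ b₀ * (1 + Real.log g⁻¹) ^ p₀
  have h1 : 0 ≤ Real.log g⁻¹ := Real.log_nonneg ((one_le_inv₀ hg).mpr hg1)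
  exact mul_nonneg hb₀.le (Real.rpow_nonneg (by linarith) _)

/-- ★★ **`TwoSidedOfWindowHerbstCap` HOLDS** (support item stmt-QuantumFields-28310 of route `MultiscaleHerbst`): `WindowHerbstCapL → TwoSidedTailL`
with `C = 1`, `A = 0`, `c = 9/(32·max(σ,1)²)` — Herbst on `[0, p]` (§1) on the window under `Gibbs_K|W`, monotonicity of the set integral, and Chernoff at
`t* = 3p/(4·max(σ,1)²) ≤ p` on `twoSidedEvent ⊆ {p ≤ X}`. [cite: Balaban1985UV3, (7) p.257] -/
theorem twoSidedOfWindowHerbstCap_proof : Summit.QuantumFields.YangMills.Theses.MultiscaleHerbst.TwoSidedOfWindowHerbstCap := by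
  unfold Summit.QuantumFields.YangMills.Theses.MultiscaleHerbst.TwoSidedOfWindowHerbstCap
  intro hWH
  unfold Summit.QuantumFields.YangMills.Theses.MultiscaleHerbst.WindowHerbstCapL at hWH
  unfold Summit.QuantumFields.YangMills.Theses.FibreConvexityTail.TwoSidedTailL
  intro L
  obtain ⟨bmin, hb⟩ := hWH L
  refine ⟨bmin, fun b₀ p₀ hbmin hb₀ hp₀ => ?_⟩
  obtain ⟨γ₁, hγ₁, hγ₁1, hF⟩ := hb b₀ p₀ hbmin hb₀ hp₀
  refine ⟨γ₁, hγ₁, hγ₁1, fun F γ hFL hγ hγle => ?_⟩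
  obtain ⟨σ, hσ, hKj⟩ := hF F γ hFL hγ hγle
  -- the enlarged variance parameter `σ' = max σ 1 ≥ 1`
  set σ' : ℝ := max σ 1 with hσ'
  have hσ'1 : 1 ≤ σ' := le_max_right _ _
  have hσ'pos : 0 < σ' := lt_of_lt_of_le one_pos hσ'1
  have hσσ' : σ ≤ σ' := le_max_left _ _
  refine ⟨1, 0, 9 / (32 * σ' ^ 2), zero_le_one, by positivity, fun K j hj hjK a => ?_⟩
  obtain ⟨W, hWm, hsub, hmean, hent⟩ := hKj K j hj hjK a
  haveI := isProbabilityMeasure_gibbsK F ℰp hγ.le K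
  rw [pow_zero, mul_one, one_mul]
  -- the coupling `g`, the exponent `p ≥ 0`, the observable `X`
  have hL1 : (1 : ℝ) ≤ F.L := by exact_mod_cast F.hL.2.le
  have hL0 : (0 : ℝ) < F.L := lt_of_lt_of_le one_pos hL1
  set g : ℝ := Real.sqrt (γ * ((F.L : ℝ)⁻¹) ^ (K - j)) with hgdef
  have hx0 : 0 < γ * ((F.L : ℝ)⁻¹) ^ (K - j) := by positivity
  have hx1 : γ * ((F.L : ℝ)⁻¹) ^ (K - j) ≤ 1 := by
    calc γ * ((F.L : ℝ)⁻¹) ^ (K - j) ≤ 1 * 1 := by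
          gcongr
          · exact hγle.trans hγ₁1
          · exact pow_le_one₀ (inv_nonneg.mpr hL0.le) (inv_le_one_of_one_le₀ hL1)
      _ = 1 := one_mul 1
  have hg0 : 0 < g := Real.sqrt_pos.mpr hx0
  have hg1 : g ≤ 1 := by rw [hgdef]; exact (Real.sqrt_le_sqrt hx1).trans_eq Real.sqrt_one
  set p : ℝ := B10.pFun b₀ p₀ g with hpdef
  have hp0 : 0 ≤ p := pFun_nonneg_of_le_one hb₀ hg0 hg1
  set X : GaugeField (F.P K) 0 (Matrix.specialUnitaryGroup (Fin 2) ℂ) → ℝ := fun U =>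
    GaugeGroup.dist1 (GaugeField.plaqHol (Averaging.iter (fun i' => BlockAveraging.blockAvg (P := F.P K) (j := i') ℰp) j U) a) / g with hX
  have hXm : Measurable X := (measurable_dist1_plaqHol_iter F K j a).div_const _
  have hXb : ∀ U, |X U| ≤ 2 / g := by
    intro U
    rw [hX]; simp only
    rw [abs_div, abs_of_pos hg0, abs_of_nonneg (GaugeGroup.dist1_nonneg _)]
    exact div_le_div_of_nonneg_right (dist1_le_two_specialUnitaryGroup _) hg0.le
  -- Herbst on `[0, p]` under `Gibbs_K|W`
  set μ := (gibbsK F ℰp γ K).restrict W with hμ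
  have hμuniv : μ.real Set.univ = (gibbsK F ℰp γ K).real W := by rw [hμ, measureReal_restrict_apply_univ]
  have hH := herbst_mgf_le_of_le μ hXm hXb (m := p / 4) (σ := σ) (T := p)
    (by rw [hμuniv]; exact hmean) (by intro t ht htp; rw [hμuniv]; exact hent t ht htp)
  -- Chernoff parameter `t* = 3p/(4σ'²) ∈ [0, p]`
  set t : ℝ := 3 * p / (4 * σ' ^ 2) with ht
  have ht0 : 0 ≤ t := by positivity
  have htp : t ≤ p := by
    rw [ht, div_le_iff₀ (by positivity)]
    nlinarith [one_le_pow₀ (n := 2) hσ'1, hp0]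
  -- the moment bound on the event
  have hsubev : twoSidedEvent F γ b₀ p₀ K j a ⊆ W := fun U hU => hsub ⟨hU.1.2, hU.2⟩
  have hintE : Integrable (fun U => Real.exp (t * X U)) ((gibbsK F ℰp γ K).restrict (twoSidedEvent F γ b₀ p₀ K j a)) :=
    (integrable_exp_mul_of_bounded (gibbsK F ℰp γ K) hXm hXb t).restrict
  have hmgf : mgf X ((gibbsK F ℰp γ K).restrict (twoSidedEvent F γ b₀ p₀ K j a)) t ≤
      Real.exp (t * (p / 4) + σ' ^ 2 * t ^ 2 / 2) := by
    have hintW : IntegrableOn (fun U => Real.exp (t * X U)) W (gibbsK F ℰp γ K) :=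
      (integrable_exp_mul_of_bounded (gibbsK F ℰp γ K) hXm hXb t).integrableOn
    calc mgf X ((gibbsK F ℰp γ K).restrict (twoSidedEvent F γ b₀ p₀ K j a)) t
        = ∫ U in twoSidedEvent F γ b₀ p₀ K j a, Real.exp (t * X U) ∂gibbsK F ℰp γ K := rfl
      _ ≤ ∫ U in W, Real.exp (t * X U) ∂gibbsK F ℰp γ K :=
          setIntegral_mono_set hintW (ae_of_all _ fun U => (Real.exp_pos _).le) (ae_of_all _ hsubev)
      _ ≤ (gibbsK F ℰp γ K).real W * Real.exp (t * (p / 4) + σ ^ 2 * t ^ 2 / 2) := by rw [← hμuniv]; exact hH t ht0 htp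
      _ ≤ 1 * Real.exp (t * (p / 4) + σ' ^ 2 * t ^ 2 / 2) := by
          refine mul_le_mul measureReal_le_one (Real.exp_le_exp.mpr ?_) (Real.exp_pos _).le zero_le_one
          nlinarith [mul_self_le_mul_self hσ.le hσσ', sq_nonneg t]
      _ = Real.exp (t * (p / 4) + σ' ^ 2 * t ^ 2 / 2) := one_mul _
  -- Chernoff on the event `⊆ {p ≤ X}`
  have hEle : twoSidedEvent F γ b₀ p₀ K j a ⊆ {U | p ≤ X U} := by
    intro U hU
    have h1 := twoSidedEvent_subset_tail F γ b₀ p₀ K j a hU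
    simp only [Set.mem_setOf_eq] at h1 ⊢
    rw [T3Thresholds.θBal_eq] at h1
    rw [hX]; simp only
    rw [le_div_iff₀ hg0]
    linarith
  have hch := measure_ge_le_exp_mul_mgf (μ := (gibbsK F ℰp γ K).restrict (twoSidedEvent F γ b₀ p₀ K j a)) (X := X) p ht0 hintE
  have hset : ((gibbsK F ℰp γ K).restrict (twoSidedEvent F γ b₀ p₀ K j a)).real {U | p ≤ X U} =
      (gibbsK F ℰp γ K).real (twoSidedEvent F γ b₀ p₀ K j a) := by
    rw [measureReal_restrict_apply (measurableSet_le measurable_const hXm), Set.inter_eq_right.mpr hEle]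
  rw [hset] at hch
  refine hch.trans ?_
  calc Real.exp (-t * p) * mgf X ((gibbsK F ℰp γ K).restrict (twoSidedEvent F γ b₀ p₀ K j a)) t
      ≤ Real.exp (-t * p) * Real.exp (t * (p / 4) + σ' ^ 2 * t ^ 2 / 2) :=
        mul_le_mul_of_nonneg_left hmgf (Real.exp_pos _).le
    _ = Real.exp (-t * p + (t * (p / 4) + σ' ^ 2 * t ^ 2 / 2)) := by rw [← Real.exp_add]
    _ = Real.exp (-(9 / (32 * σ' ^ 2) * p ^ 2)) := by rw [ht, ChernoffOnEvent.chernoff_exponent hσ'pos p]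

end Summit.QuantumFields.YangMills.Theorems.MultiscaleHerbstCap

end
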